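import Summits.ValiantsHypothesis.ValiantsHypothesis.Theorems.KPlusLogSqLawMixedGaugeOneFastMode

/-!
# Route «KPlusLogSqLaw», `WeakLifting` (stmt-ValiantsHypothesis-19561) — the ONE-FAST-MODE LAW at exponent ratio 3 : 2:
# at most `n + 2` distinct positive determinant zeros, against Descartes' `2n + 1`

HONEST FRAMING.  Helper file (seat val-sym-lift-p4 g26, cell `pub-symmetroid`, 2026-08-29; `--supports 19561 --as helper`,
zero crux credit), companion of `…KPlusLogSqLawMixedGaugeOneFastMode` (ratio 3).  Same mixed-sign vertex-gauge shape — `n`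
slow POSITIVE diagonal monomials against ONE fast NEGATIVE diagonal monomial and one constant symmetric letter — now with the
exponents `2a < 3a`: the bordered lacunary pencil `[[A + X^{2a}·1, v], [vᵀ, c − X^{3a}]]`.  Here the two monomial bands of
the determinant, `x^{2a·i}` and `x^{3a + 2a·i}` (`i ≤ n`), INTERLEAVE without a single coincidence, so Descartes' rule allows
`2n + 1` positive roots; THEOREM (`card_posRoots_det_borderedPencil_le_threeHalves`): there are at most `n + 2`.
MECHANISM: the two-point identity of the ratio-3 file in the variable `p = x^a` reads `(p'² − p²)·⟪w,w'⟫ = (p'³ − p³)·q q'`;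
two «downward» zeros (`2‖w‖² ≤ 3 p q²`) force `4(p² + p p' + p'²)² ≤ 9 p p' (p + p')²`, i.e. `(p − p')²(4p² + 7pp' + 4p'²) ≤ 0`
(`not_two_down_threeHalves`); and `n + 2` «upward» zeros give a relation `Σ dⱼ wⱼ = 0, Σ dⱼ qⱼ = 0`, for which the scalar
`Φ = Σⱼₖ dⱼ dₖ (pₖ² ⟪wⱼ,wₖ⟫ − pₖ³ qⱼ qₖ)` vanishes identically but also equals
`Σⱼ dⱼ² pⱼ² (‖wⱼ‖² − 3/2·pⱼ qⱼ²) + Σⱼₖ yⱼ yₖ /(pⱼ + pₖ)` (`yⱼ = dⱼ qⱼ pⱼ²`), a positive number: the last double sum is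
the HILBERT–CAUCHY quadratic form, non-negative by one step of symmetric elimination
(`cauchy_quadratic_nonneg`, the Loewner matrix of `√·`).  Located law for every ratio in the seat memo MIXED-GAUGE-LAW.md.
Nothing here is about `WeakLifting` / `TropicalB` in their windows, the doors, `MatrixDescartes` (18050) or VP ≠ VNP.
No `def`; axioms standard.  [folklore linear algebra (Cauchy matrix); the count law appears to be new — presearch in memo]
-/

set_option linter.dupNamespace false
set_option autoImplicit false

namespace Summit.ValiantsHypothesis.ValiantsHypothesis.Theorems.KPlusLogSqLaw

open Matrix Finset
open scoped BigOperators

namespace MixedGauge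

variable {n : ℕ}

/-! ## 1. The Hilbert–Cauchy quadratic form is non-negative -/

/-- **Cauchy matrix.**  For positive `p₀, …, p_{m−1}` and real `y`, `0 ≤ Σⱼ Σₖ yⱼ yₖ / (pⱼ + pₖ)`.  One elimination step:
`Σⱼₖ yⱼyₖ/(pⱼ+pₖ) = (y₀ + 2p₀ Σ_{j≥1} yⱼ/(p₀+pⱼ))²/(2p₀) + Σ_{j,k≥1} (yⱼDⱼ)(yₖDₖ)/(pⱼ+pₖ)` with `Dⱼ = (pⱼ − p₀)/(pⱼ + p₀)`,
then induction. [folklore] -/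
theorem cauchy_quadratic_nonneg : ∀ (m : ℕ) (p y : Fin m → ℝ), (∀ i, 0 < p i) →
    0 ≤ ∑ j, ∑ k, y j * y k / (p j + p k) := by
  intro m
  induction m with
  | zero => intro p y _; simp
  | succ m ih =>
    intro p y hp
    have hp0 : 0 < p 0 := hp 0
    -- the tail data after elimination of index 0
    let p' : Fin m → ℝ := fun i => p i.succ
    let D : Fin m → ℝ := fun i => (p i.succ - p 0) / (p i.succ + p 0)
    let y' : Fin m → ℝ := fun i => y i.succ * D i
    have hp' : ∀ i, 0 < p' i := fun i => hp i.succ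
    have htail := ih p' y' hp'
    -- termwise identity for the tail block
    have hterm : ∀ j k : Fin m, y j.succ * y k.succ / (p j.succ + p k.succ) =
        2 * p 0 * (y j.succ / (p 0 + p j.succ)) * (y k.succ / (p 0 + p k.succ)) + y' j * y' k / (p' j + p' k) := by
      intro j k
      have hj : 0 < p j.succ := hp j.succ
      have hk : 0 < p k.succ := hp k.succ
      simp only [y', D, p']
      field_simp
      ring
    -- expand the double sum over Fin (m+1): split off index 0 in both variables
    let S : ℝ := ∑ j : Fin m, y j.succ / (p 0 + p j.succ)
    let F : Fin (m + 1) → Fin (m + 1) → ℝ := fun j k => y j * y k / (p j + p k)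
    have e1 : ∑ j, ∑ k, F j k = ∑ k, F 0 k + ∑ j : Fin m, ∑ k, F j.succ k := Fin.sum_univ_succ _
    have e2 : ∑ k, F 0 k = F 0 0 + ∑ k : Fin m, F 0 k.succ := Fin.sum_univ_succ _
    have e3 : ∀ j : Fin m, ∑ k, F j.succ k = F j.succ 0 + ∑ k : Fin m, F j.succ k.succ :=
      fun j => Fin.sum_univ_succ _
    have h00 : F 0 0 = y 0 ^ 2 / (2 * p 0) := by simp only [F]; rw [← two_mul]; ring
    have h0k : ∑ k : Fin m, F 0 k.succ = y 0 * S := by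
      simp only [F, S, Finset.mul_sum]
      refine Finset.sum_congr rfl fun k _ => ?_
      ring
    have hj0 : ∑ j : Fin m, F j.succ 0 = y 0 * S := by
      simp only [F, S, Finset.mul_sum]
      refine Finset.sum_congr rfl fun j _ => ?_
      rw [add_comm (p j.succ)]
      ring
    have hSS : ∑ j : Fin m, ∑ k : Fin m, 2 * p 0 * (y j.succ / (p 0 + p j.succ)) * (y k.succ / (p 0 + p k.succ)) =
        2 * p 0 * S ^ 2 := by
      rw [pow_two, Finset.sum_mul_sum, Finset.mul_sum]
      refine Finset.sum_congr rfl fun j _ => ?_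
      rw [Finset.mul_sum]
      refine Finset.sum_congr rfl fun k _ => ?_
      ring
    have hT2 : ∑ j : Fin m, ∑ k : Fin m, F j.succ k.succ = 2 * p 0 * S ^ 2 + ∑ j, ∑ k, y' j * y' k / (p' j + p' k) := by
      simp only [F]
      simp_rw [hterm, Finset.sum_add_distrib]
      rw [hSS]
    have htot : ∑ j, ∑ k, F j k = (y 0 + 2 * p 0 * S) ^ 2 / (2 * p 0) + ∑ j, ∑ k, y' j * y' k / (p' j + p' k) := by
      rw [e1, e2]
      simp_rw [e3]
      rw [Finset.sum_add_distrib, h00, h0k, hj0, hT2]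
      field_simp
      ring
    have hfirst : 0 ≤ (y 0 + 2 * p 0 * S) ^ 2 / (2 * p 0) := by positivity
    show 0 ≤ ∑ j, ∑ k, F j k
    rw [htot]
    exact add_nonneg hfirst htail

/-! ## 2. Ratio 3 : 2 — two distinct zeros are never both downward -/

/-- **No two downward zeros at ratio 3 : 2** (variable `p = x^a`, `s = p²`, `t = p³`): the two-point identity
`(p'² − p²)·⟪w,w'⟫ = (p'³ − p³)·q q'`, both kernel vectors non-zero and both «downward» (`2⟪w,w⟫ ≤ 3 p q²`) contradict
`p ≠ p'`, because `4(p² + pp' + p'²)² − 9pp'(p + p')² = (p − p')²(4p² + 7pp' + 4p'²) > 0`. -/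
theorem not_two_down_threeHalves (p p' : ℝ) (hp : 0 < p) (hp' : 0 < p') (hne : p ≠ p') (w w' : Fin n → ℝ) (q q' : ℝ)
    (hid : (p' ^ 2 - p ^ 2) * (w ⬝ᵥ w') = (p' ^ 3 - p ^ 3) * (q * q'))
    (hnz : w ≠ 0 ∨ q ≠ 0) (hnz' : w' ≠ 0 ∨ q' ≠ 0)
    (hd : 2 * (w ⬝ᵥ w) ≤ 3 * p * q ^ 2) (hd' : 2 * (w' ⬝ᵥ w') ≤ 3 * p' * q' ^ 2) : False := by
  have hww : 0 ≤ w ⬝ᵥ w := by rw [dotProduct]; exact Finset.sum_nonneg fun i _ => mul_self_nonneg _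
  have hww' : 0 ≤ w' ⬝ᵥ w' := by rw [dotProduct]; exact Finset.sum_nonneg fun i _ => mul_self_nonneg _
  have hq : q ≠ 0 := by
    rcases hnz with hw | hq
    · intro hq0
      rw [hq0] at hd
      have : w ⬝ᵥ w = 0 := le_antisymm (by nlinarith) hww
      exact hw (dotProduct_self_eq_zero.mp this)
    · exact hq
  have hq' : q' ≠ 0 := by
    rcases hnz' with hw | hq'
    · intro hq0
      rw [hq0] at hd'
      have : w' ⬝ᵥ w' = 0 := le_antisymm (by nlinarith) hww'
      exact hw (dotProduct_self_eq_zero.mp this)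
    · exact hq'
  have hCS : (w ⬝ᵥ w') ^ 2 ≤ (w ⬝ᵥ w) * (w' ⬝ᵥ w') := by
    have h := Finset.sum_mul_sq_le_sq_mul_sq (Finset.univ : Finset (Fin n)) w w'
    simpa only [dotProduct, pow_two] using h
  have hprod : 4 * ((w ⬝ᵥ w) * (w' ⬝ᵥ w')) ≤ (3 * p * q ^ 2) * (3 * p' * q' ^ 2) := by
    have := mul_le_mul hd hd' (by positivity) (by positivity)
    linarith
  have hsq : (p' ^ 2 - p ^ 2) ^ 2 * (w ⬝ᵥ w') ^ 2 = (p' ^ 3 - p ^ 3) ^ 2 * (q * q') ^ 2 := by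
    have := congrArg (fun z => z ^ 2) hid
    simpa [mul_pow] using this
  have hD : 0 < (p' - p) ^ 2 := by
    have : p' - p ≠ 0 := sub_ne_zero.mpr (Ne.symm hne)
    positivity
  have hqq : 0 < (q * q') ^ 2 := by
    have : q * q' ≠ 0 := mul_ne_zero hq hq'
    positivity
  -- 4 (p'³ − p³)² (qq')² ≤ (p'² − p²)² · 9 p p' (qq')²
  have h1 : 4 * ((p' ^ 3 - p ^ 3) ^ 2 * (q * q') ^ 2) ≤ (p' ^ 2 - p ^ 2) ^ 2 * (9 * (p * p') * (q * q') ^ 2) := by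
    rw [← hsq]
    have : 4 * (w ⬝ᵥ w') ^ 2 ≤ 9 * (p * p') * (q * q') ^ 2 := by nlinarith
    nlinarith [sq_nonneg (p' ^ 2 - p ^ 2)]
  -- cancel (p' − p)² (qq')² > 0
  have hE : 4 * (p' ^ 2 + p * p' + p ^ 2) ^ 2 ≤ 9 * (p * p') * (p' + p) ^ 2 := by
    have h2 : (p' - p) ^ 2 * (q * q') ^ 2 * (4 * (p' ^ 2 + p * p' + p ^ 2) ^ 2) ≤
        (p' - p) ^ 2 * (q * q') ^ 2 * (9 * (p * p') * (p' + p) ^ 2) := by nlinarith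
    exact le_of_mul_le_mul_left h2 (mul_pos hD hqq)
  -- but 4(p² + pp' + p'²)² − 9pp'(p + p')² = (p − p')²(4p² + 7pp' + 4p'²) > 0
  have hpos : 0 < (p' - p) ^ 2 * (4 * p ^ 2 + 7 * p * p' + 4 * p' ^ 2) := mul_pos hD (by positivity)
  nlinarith

/-! ## 3. Ratio 3 : 2 — at most `n + 1` upward zeros -/

/-- **Upward zeros are few at ratio 3 : 2.**  `n + 2` points `0 < pⱼ`, pairwise distinct, vectors `wⱼ ∈ ℝⁿ`, scalars `qⱼ`,
pairwise identities `(pₖ² − pⱼ²)·⟪wⱼ,wₖ⟫ = (pₖ³ − pⱼ³)·qⱼqₖ` and all «upward» (`3 pⱼ qⱼ² < 2⟪wⱼ,wⱼ⟫`) cannot exist. -/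
theorem up_card_le_threeHalves (p : Fin (n + 2) → ℝ) (hp : ∀ j, 0 < p j) (hinj : Function.Injective p)
    (w : Fin (n + 2) → (Fin n → ℝ)) (q : Fin (n + 2) → ℝ)
    (hid : ∀ j k, j ≠ k → (p k ^ 2 - p j ^ 2) * (w j ⬝ᵥ w k) = (p k ^ 3 - p j ^ 3) * (q j * q k))
    (hup : ∀ j, 3 * p j * q j ^ 2 < 2 * (w j ⬝ᵥ w j)) : False := by
  classical
  -- a non-trivial relation Σ dⱼ wⱼ = 0, Σ dⱼ qⱼ = 0
  let f : (Fin (n + 2) → ℝ) →ₗ[ℝ] ((Fin n → ℝ) × ℝ) :=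
    { toFun := fun d => (∑ j, d j • w j, ∑ j, d j * q j)
      map_add' := by
        intro d d'
        simp only [Pi.add_apply, add_smul, add_mul, Finset.sum_add_distrib, Prod.mk_add_mk]
      map_smul' := by
        intro r d
        simp only [Pi.smul_apply, smul_eq_mul, mul_smul, ← Finset.smul_sum, RingHom.id_apply, Prod.smul_mk,
          mul_assoc, ← Finset.mul_sum] }
  have hker : LinearMap.ker f ≠ ⊥ := by
    apply LinearMap.ker_ne_bot_of_finrank_lt
    rw [Module.finrank_prod, Module.finrank_fin_fun, Module.finrank_fin_fun, Module.finrank_self]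
    omega
  obtain ⟨d, hdker, hd0⟩ := (Submodule.ne_bot_iff _).mp hker
  have hfd : f d = 0 := LinearMap.mem_ker.mp hdker
  have hsumw : ∑ j, d j • w j = 0 := (Prod.mk_eq_zero.mp hfd).1
  have hsumq : ∑ j, d j * q j = 0 := (Prod.mk_eq_zero.mp hfd).2
  -- off-diagonal Gram entries: ⟪wⱼ,wₖ⟫ (pⱼ + pₖ) = (pⱼ² + pⱼpₖ + pₖ²) qⱼ qₖ
  have hG : ∀ j k, j ≠ k → (w j ⬝ᵥ w k) * (p j + p k) = (p j ^ 2 + p j * p k + p k ^ 2) * (q j * q k) := by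
    intro j k hjk
    have hne : p k - p j ≠ 0 := sub_ne_zero.mpr (fun h => hjk (hinj h).symm)
    have h := hid j k hjk
    have h' : (p k - p j) * ((w j ⬝ᵥ w k) * (p j + p k)) =
        (p k - p j) * ((p j ^ 2 + p j * p k + p k ^ 2) * (q j * q k)) := by
      have e1 : (p k - p j) * ((w j ⬝ᵥ w k) * (p j + p k)) = (p k ^ 2 - p j ^ 2) * (w j ⬝ᵥ w k) := by ring
      have e2 : (p k - p j) * ((p j ^ 2 + p j * p k + p k ^ 2) * (q j * q k)) = (p k ^ 3 - p j ^ 3) * (q j * q k) := by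
        ring
      rw [e1, e2, h]
    exact mul_left_cancel₀ hne h'
  -- the scalar Φ = Σⱼₖ dⱼ dₖ (pₖ² ⟪wⱼ,wₖ⟫ − pₖ³ qⱼ qₖ) vanishes …
  have hPhi0 : ∑ j, ∑ k, d j * d k * (p k ^ 2 * (w j ⬝ᵥ w k) - p k ^ 3 * (q j * q k)) = 0 := by
    have hsplit : ∀ j k, d j * d k * (p k ^ 2 * (w j ⬝ᵥ w k) - p k ^ 3 * (q j * q k)) =
        (d k * p k ^ 2) * ((d j • w j) ⬝ᵥ w k) - (d j * q j) * (d k * p k ^ 3 * q k) := by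
      intro j k
      rw [smul_dotProduct, smul_eq_mul]
      ring
    simp_rw [hsplit, Finset.sum_sub_distrib]
    rw [Finset.sum_comm]
    simp_rw [← Finset.mul_sum, ← sum_dotProduct, hsumw, zero_dotProduct, mul_zero, Finset.sum_const_zero, zero_sub]
    rw [← Finset.sum_mul, hsumq, zero_mul, neg_zero]
  -- … but termwise it is the Hilbert–Cauchy form of yⱼ = dⱼ qⱼ pⱼ² plus a positive diagonal
  have hterm : ∀ j k, d j * d k * (p k ^ 2 * (w j ⬝ᵥ w k) - p k ^ 3 * (q j * q k)) =
      (d j * q j * p j ^ 2) * (d k * q k * p k ^ 2) / (p j + p k)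
        + (if j = k then d j ^ 2 * p j ^ 2 * ((w j ⬝ᵥ w j) - 3 / 2 * p j * q j ^ 2) else 0) := by
    intro j k
    have hjk_pos : 0 < p j + p k := add_pos (hp j) (hp k)
    by_cases hjk : j = k
    · subst hjk
      rw [if_pos rfl]
      field_simp
      ring
    · rw [if_neg hjk, add_zero]
      have hg := hG j k hjk
      rw [eq_div_iff (ne_of_gt hjk_pos)]
      have : d j * d k * (p k ^ 2 * (w j ⬝ᵥ w k) - p k ^ 3 * (q j * q k)) * (p j + p k) =
          d j * d k * (p k ^ 2 * ((w j ⬝ᵥ w k) * (p j + p k)) - p k ^ 3 * (q j * q k) * (p j + p k)) := by ring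
      rw [this, hg]
      ring
  have hdouble : ∑ j, ∑ k, d j * d k * (p k ^ 2 * (w j ⬝ᵥ w k) - p k ^ 3 * (q j * q k)) =
      (∑ j, ∑ k, (d j * q j * p j ^ 2) * (d k * q k * p k ^ 2) / (p j + p k))
        + ∑ j, d j ^ 2 * p j ^ 2 * ((w j ⬝ᵥ w j) - 3 / 2 * p j * q j ^ 2) := by
    simp_rw [hterm, Finset.sum_add_distrib, Finset.sum_ite_eq, Finset.mem_univ, if_true]
  have hH : 0 ≤ ∑ j, ∑ k, (d j * q j * p j ^ 2) * (d k * q k * p k ^ 2) / (p j + p k) :=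
    cauchy_quadratic_nonneg (n + 2) p (fun j => d j * q j * p j ^ 2) hp
  have hdiag : 0 < ∑ j, d j ^ 2 * p j ^ 2 * ((w j ⬝ᵥ w j) - 3 / 2 * p j * q j ^ 2) := by
    obtain ⟨j0, hj0⟩ : ∃ j, d j ≠ 0 := by
      by_contra h
      push Not at h
      exact hd0 (funext h)
    apply Finset.sum_pos'
    · intro j _
      exact mul_nonneg (mul_nonneg (sq_nonneg _) (sq_nonneg _)) (by linarith [hup j])
    · exact ⟨j0, Finset.mem_univ _, mul_pos (mul_pos (by positivity) (pow_pos (hp j0) 2)) (by linarith [hup j0])⟩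
  rw [hdouble] at hPhi0
  linarith

/-! ## 4. The count at ratio 3 : 2 -/

/-- **ONE FAST NEGATIVE MODE COSTS AT MOST TWO (ratio 3 : 2).**  `A` real symmetric `n × n`, `v ∈ ℝⁿ`, `c ∈ ℝ`, `1 ≤ a`:
if every `x` in a finite set `S` of positive reals admits a non-zero kernel vector `(w, q)` of
`[[A + x^{2a}·1, v], [vᵀ, c − x^{3a}]]`, then `#S ≤ n + 2`. -/
theorem card_posZeros_le_threeHalves (A : Matrix (Fin n) (Fin n) ℝ) (hA : A.IsSymm) (v : Fin n → ℝ) (c : ℝ) (a : ℕ)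
    (ha : 1 ≤ a) (S : Finset ℝ)
    (hS : ∀ x ∈ S, 0 < x ∧ ∃ w : Fin n → ℝ, ∃ q : ℝ, (w ≠ 0 ∨ q ≠ 0) ∧
      (A + (x ^ (2 * a)) • (1 : Matrix (Fin n) (Fin n) ℝ)) *ᵥ w + q • v = 0 ∧
        v ⬝ᵥ w + (c - x ^ (3 * a)) * q = 0) :
    S.card ≤ n + 2 := by
  classical
  have hx : ∀ x : S, 0 < (x : ℝ) := fun x => (hS x x.2).1
  choose W Q hWQ using fun x : S => (hS x x.2).2
  -- the variable p = x^a: x^{2a} = p², x^{3a} = p³, distinct x give distinct p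
  have hpow2 : ∀ x : ℝ, x ^ (2 * a) = (x ^ a) ^ 2 := fun x => by rw [mul_comm, pow_mul]
  have hpow3 : ∀ x : ℝ, x ^ (3 * a) = (x ^ a) ^ 3 := fun x => by rw [mul_comm, pow_mul]
  have hsinj : ∀ x y : S, (x : ℝ) ^ a = (y : ℝ) ^ a → x = y := by
    intro x y h
    have ha0 : a ≠ 0 := by omega
    exact Subtype.ext ((pow_left_inj₀ (hx x).le (hx y).le ha0).mp h)
  have hid : ∀ x y : S, (((y : ℝ) ^ a) ^ 2 - ((x : ℝ) ^ a) ^ 2) * (W x ⬝ᵥ W y) =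
      (((y : ℝ) ^ a) ^ 3 - ((x : ℝ) ^ a) ^ 3) * (Q x * Q y) := by
    intro x y
    have h := two_point A hA v c ((x : ℝ) ^ (2 * a)) ((x : ℝ) ^ (3 * a)) ((y : ℝ) ^ (2 * a)) ((y : ℝ) ^ (3 * a))
      (W x) (W y) (Q x) (Q y) (hWQ x).2.1 (hWQ x).2.2 (hWQ y).2.1 (hWQ y).2.2
    rw [hpow2, hpow2, hpow3, hpow3] at h
    exact h
  let down : ℝ → Prop := fun x => if hxS : x ∈ S then
    2 * (W ⟨x, hxS⟩ ⬝ᵥ W ⟨x, hxS⟩) ≤ 3 * (x ^ a) * Q ⟨x, hxS⟩ ^ 2 else False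
  have hsplit := Finset.card_filter_add_card_filter_not (s := S) down
  have hdown : (S.filter down).card ≤ 1 := by
    refine Finset.card_le_one.mpr ?_
    intro x hxm y hym
    rw [Finset.mem_filter] at hxm hym
    obtain ⟨hxS, hxd⟩ := hxm
    obtain ⟨hyS, hyd⟩ := hym
    simp only [down, dif_pos hxS] at hxd
    simp only [down, dif_pos hyS] at hyd
    by_contra hxy
    have hne : (x : ℝ) ^ a ≠ y ^ a := fun h => hxy (congrArg Subtype.val (hsinj ⟨x, hxS⟩ ⟨y, hyS⟩ h))
    exact not_two_down_threeHalves (x ^ a) (y ^ a) (pow_pos (hx ⟨x, hxS⟩) a) (pow_pos (hx ⟨y, hyS⟩) a) hne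
      (W ⟨x, hxS⟩) (W ⟨y, hyS⟩) (Q ⟨x, hxS⟩) (Q ⟨y, hyS⟩) (hid ⟨x, hxS⟩ ⟨y, hyS⟩)
      (hWQ ⟨x, hxS⟩).1 (hWQ ⟨y, hyS⟩).1 hxd hyd
  have hupc : (S.filter fun x => ¬ down x).card ≤ n + 1 := by
    by_contra hlt
    push Not at hlt
    obtain ⟨T, hTsub, hTcard⟩ := Finset.exists_subset_card_eq (show n + 2 ≤ (S.filter fun x => ¬ down x).card by omega)
    have hTS : ∀ x ∈ T, x ∈ S := fun x hx => (Finset.mem_filter.mp (hTsub hx)).1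
    have hTup : ∀ x (hx : x ∈ T), 3 * (x ^ a) * Q ⟨x, hTS x hx⟩ ^ 2 < 2 * (W ⟨x, hTS x hx⟩ ⬝ᵥ W ⟨x, hTS x hx⟩) := by
      intro x hx
      have h := (Finset.mem_filter.mp (hTsub hx)).2
      simp only [down, dif_pos (hTS x hx), not_le] at h
      exact h
    let e : Fin (n + 2) ≃ T := (T.equivFinOfCardEq hTcard).symm
    let emb : Fin (n + 2) → S := fun j => ⟨(e j : ℝ), hTS _ (e j).2⟩
    have hembinj : Function.Injective emb := by
      intro j k h
      have h' : ((emb j : S) : ℝ) = ((emb k : S) : ℝ) := congrArg Subtype.val h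
      exact e.injective (Subtype.ext h')
    refine up_card_le_threeHalves (fun j => ((emb j : S) : ℝ) ^ a) (fun j => pow_pos (hx (emb j)) a) ?_
      (fun j => W (emb j)) (fun j => Q (emb j)) ?_ ?_
    · intro j k h
      exact hembinj (hsinj _ _ h)
    · intro j k _
      exact hid (emb j) (emb k)
    · intro j
      exact hTup (e j : ℝ) (e j).2
  omega

/-! ## 5. Determinant currency -/

/-- evaluation of the ratio-3:2 bordered pencil at a real point. -/
theorem eval_borderedPencil_threeHalves (A : Matrix (Fin n) (Fin n) ℝ) (v : Fin n → ℝ) (c : ℝ) (a : ℕ) (x : ℝ) :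
    (Polynomial.evalRingHom x).mapMatrix
        (Matrix.fromBlocks (A.map Polynomial.C + ((Polynomial.X : Polynomial ℝ) ^ (2 * a)) • 1)
          (Matrix.of fun i (_ : Unit) => Polynomial.C (v i)) (Matrix.of fun (_ : Unit) j => Polynomial.C (v j))
          ((Polynomial.C c - (Polynomial.X : Polynomial ℝ) ^ (3 * a)) • (1 : Matrix Unit Unit (Polynomial ℝ)))) =
      Matrix.fromBlocks (A + (x ^ (2 * a)) • (1 : Matrix (Fin n) (Fin n) ℝ)) (Matrix.of fun i (_ : Unit) => v i)
        (Matrix.of fun (_ : Unit) j => v j) ((c - x ^ (3 * a)) • (1 : Matrix Unit Unit ℝ)) := by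
  rw [RingHom.mapMatrix_apply, Matrix.fromBlocks_map]
  congr 1
  · ext i j
    by_cases h : i = j
    · subst h; simp
    · simp [Matrix.one_apply_ne h]
  · ext i j
    simp
  · ext i j
    simp
  · ext i j
    simp

/-- **THE ONE-FAST-MODE LAW at ratio 3 : 2, determinant currency.**  For `A` real symmetric `n × n`, `v ∈ ℝⁿ`, `c ∈ ℝ`
and `1 ≤ a`, the determinant of the bordered lacunary pencil `[[A + X^{2a}·1, v], [vᵀ, c − X^{3a}]]` has at most `n + 2`
distinct positive real roots — Descartes' rule of signs allows `2n + 1` (the bands `x^{2ai}` and `x^{3a + 2ai}` never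
coincide). -/
theorem card_posRoots_det_borderedPencil_le_threeHalves (A : Matrix (Fin n) (Fin n) ℝ) (hA : A.IsSymm)
    (v : Fin n → ℝ) (c : ℝ) (a : ℕ) (ha : 1 ≤ a) :
    ((Matrix.det (Matrix.fromBlocks (A.map Polynomial.C + ((Polynomial.X : Polynomial ℝ) ^ (2 * a)) • 1)
          (Matrix.of fun i (_ : Unit) => Polynomial.C (v i)) (Matrix.of fun (_ : Unit) j => Polynomial.C (v j))
          ((Polynomial.C c - (Polynomial.X : Polynomial ℝ) ^ (3 * a)) •
            (1 : Matrix Unit Unit (Polynomial ℝ))))).roots.toFinset.filter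
        (fun x => 0 < x)).card ≤ n + 2 := by
  classical
  refine card_posZeros_le_threeHalves A hA v c a ha _ ?_
  intro x hx
  rw [Finset.mem_filter, Multiset.mem_toFinset, Polynomial.mem_roots'] at hx
  obtain ⟨⟨_, hroot⟩, hxpos⟩ := hx
  refine ⟨hxpos, ?_⟩
  have hdet : (Matrix.fromBlocks (A + (x ^ (2 * a)) • (1 : Matrix (Fin n) (Fin n) ℝ)) (Matrix.of fun i (_ : Unit) => v i)
      (Matrix.of fun (_ : Unit) j => v j) ((c - x ^ (3 * a)) • (1 : Matrix Unit Unit ℝ))).det = 0 := by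
    rw [← eval_borderedPencil_threeHalves, ← RingHom.map_det]
    exact hroot
  obtain ⟨u, hu0, hu⟩ := Matrix.exists_mulVec_eq_zero_iff.mpr hdet
  rw [Matrix.fromBlocks_mulVec] at hu
  have h1 := congrFun hu
  refine ⟨u ∘ Sum.inl, u (Sum.inr ()), ?_, ?_, ?_⟩
  · by_contra hboth
    push Not at hboth
    apply hu0
    funext i
    rcases i with i | ⟨⟩
    · exact congrFun hboth.1 i
    · exact hboth.2
  · funext i
    have hi := h1 (Sum.inl i)
    simp only [Sum.elim_inl, Pi.add_apply, Pi.zero_apply] at hi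
    have hB : ((Matrix.of fun i (_ : Unit) => v i) *ᵥ (u ∘ Sum.inr)) i = (u (Sum.inr ()) • v) i := by
      simp [Matrix.mulVec, dotProduct, mul_comm]
    rw [hB] at hi
    simpa only [Pi.add_apply, Pi.zero_apply] using hi
  · have hi := h1 (Sum.inr ())
    simp only [Sum.elim_inr, Pi.add_apply, Pi.zero_apply] at hi
    have hC : ((Matrix.of fun (_ : Unit) j => v j) *ᵥ (u ∘ Sum.inl)) () = v ⬝ᵥ (u ∘ Sum.inl) := by
      simp [Matrix.mulVec]
    have hD : (((c - x ^ (3 * a)) • (1 : Matrix Unit Unit ℝ)) *ᵥ (u ∘ Sum.inr)) () =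
        (c - x ^ (3 * a)) * u (Sum.inr ()) := by
      simp [Matrix.mulVec, dotProduct]
    rw [hC, hD] at hi
    exact hi

end MixedGauge

end Summit.ValiantsHypothesis.ValiantsHypothesis.Theorems.KPlusLogSqLaw
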